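import Summits.ResolutionOfSingularities.ResolutionOfSingularities.Theorems.ValuativeLuAlphaPTorsorToroidalExitEngine
import Summits.ResolutionOfSingularities.ResolutionOfSingularities.Theorems.ValuativeLuAlphaPTorsorToroidalExitLattice
import Literature.AlgebraicGeometry.Resolution.MonomialIdealsRegularParameters
import Literature.AlgebraicGeometry.Resolution.RankOneReductionProofs
import Literature.AlgebraicGeometry.Resolution.ArithmeticalThreefolds

/-!
# `Valuative.LuAlphaPTorsor`, line `pfaff-line-log-final-forms`: the toroidal exit

Route `ResolutionOfSingularities/Valuative`, crux `LuAlphaPTorsor` (stmt-0641), stub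
`stub_toroidalExit` of the lead's skeleton `Cruxes/LuAlphaPTorsor/Lines/pfaff-line-log-final-forms.lean`,
PROVED here (statement verbatim from the ledger registration).

**Statement.** `A₁ ⊆ O` a finitely generated `k`-subalgebra of the valued field `(K, O)`,
`char k = p`, regular at the centre `𝔭 = 𝔪_O ∩ A₁`, `t ∈ K` with `t ^ p ∈ A₁` and `Frac (A₁[t]) = K`;
in the regular local ring `R = (A₁)_𝔭` with regular system of parameters `u₁, …, u_d` suppose
`t ^ p - c ^ p = u^M · B` with `B` a unit and `p ∤ M_{i₀}` for some `i₀` (the "toroidal datum" of the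
final-form trichotomy). Then some finitely generated `A ⊇ A₁` with `t ∈ A ⊆ O`, `Frac A = K` is
regular at the centre — toric local uniformization of the binomial hypersurface `t'^p = u^M` along
an ARBITRARY valuation ring `O`, relative to the regular base `R`.

**Proof.**
* *Kill the unit* (§1): with `α M_{i₀} = 1 + β p`, replace `u_{i₀}` by `u_{i₀} B^α` (still a regular
  system of parameters) and `t` by `t' = (t - c) B^β ∈ K`; then `t'^p = ∏ u_i ^ M_i` exactly.
* *Monomial chart* (helper file 3, Zariski–Perron): `z₁, …, z_n ∈ O`, `n ≤ d`, Laurent monomials in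
  `u, t'`, with `u_i = z^{N_i}`, `t' = z^{N_T}` (`ℕ`-exponents). Input: the monomials `u^a` are
  pairwise distinct (monomial membership for regular parameters, tree
  `IsRsopPart.uPow_mem_span_uPow_iff`).
* *The model* `A := A₁[t, z₁, …, z_n] ⊆ O` (§3), and *regularity at the centre* by the engine of
  helper file 2 with `I₁ = {j : ν(z_j) > 0}`, `I₀ = I₁ ∪ {t}`: `𝔪_R = (u)` maps into `(z_j : j ∈ I₁)`
  (each `u_i = z^{N_i}` has positive value, so involves some `z_j` of positive value), and
  `t ≡ c` modulo that ideal (`t - c = t' B^{-β}`, `t'` of positive value); the count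
  `#I₁ + (n + 1) ≤ d + (#I₁ + 1)` is `n ≤ d`.
-/

/- Work log (stub-worker, 2026-08-16): regularity is NOT obtained through flatness of `R` over `𝔽_p[u]`
+ Matsumura 23.7 (the brief's plan) but by a generator/dimension count through `(A₁)_𝔭[X_σ]`
(going-down for the free extension `R → R[X]`, Mathlib; affine dimension formula, tree), which needs
neither flatness of the toric algebra nor irreducibility of `T^p - u^M`; units among the `z_j` are
absorbed by the count. Pitfall: `MvPolynomial σ (Localization.AtPrime 𝔭)` over subalgebra carriers
gives `whnf` time-outs, so the engine is abstract and applied to the `Subring` carriers. -/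

noncomputable section

-- `Summit.<S>.<S>.…` duplicates the summit name by design (D-0017, single-problem summit).
set_option linter.dupNamespace false

open IsLocalRing

namespace Summit.ResolutionOfSingularities.ResolutionOfSingularities.Theorems.PfaffLine

open Literature.AlgebraicGeometry.Resolution

/-! ## §1 Glue -/

section Glue

variable {k K : Type} [Field k] [Field K] [Algebra k K]

-- adapted from Cruxes/LuAlphaPTorsor/Disproof.lean §Helpers
/-- Valuation rings are integrally closed, in the only form needed: `t ^ n ∈ O ⇒ t ∈ O`. -/
theorem mem_of_pow_mem' (O : ValuationSubring K) {t : K} {n : ℕ} (hn : n ≠ 0) (h : t ^ n ∈ O) :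
    t ∈ O := by
  rw [← O.valuation_le_one_iff] at h ⊢
  rw [map_pow] at h
  by_contra hlt
  exact (one_lt_pow₀ (lt_of_not_ge hlt) hn).not_ge h

/-- An element of value `< 1` of a power-product of elements of `O` forces a factor of value
`< 1` with positive exponent. -/
theorem exists_factor_lt_one (O : ValuationSubring K) {n : ℕ} (z : Fin n → K)
    (hz : ∀ j, z j ∈ O) (N : Fin n → ℕ) (h : O.valuation (∏ j, z j ^ N j) < 1) :
    ∃ j₀, 0 < N j₀ ∧ O.valuation (z j₀) < 1 := by
  by_contra hcon
  push Not at hcon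
  have : O.valuation (∏ j, z j ^ N j) = 1 := by
    rw [map_prod]
    refine Finset.prod_eq_one fun j _ => ?_
    rw [map_pow]
    rcases Nat.eq_zero_or_pos (N j) with h0 | hpos
    · rw [h0, pow_zero]
    · have h1 : O.valuation (z j) = 1 :=
        le_antisymm ((O.valuation_le_one_iff _).mpr (hz j)) (hcon j hpos)
      rw [h1, one_pow]
  rw [this] at h
  exact lt_irrefl _ h

/-- Splitting off one factor of a power-product. -/
theorem prod_pow_eq_mul_of_pos {M : Type*} [CommMonoid M] {n : ℕ} (z : Fin n → M) (N : Fin n → ℕ)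
    {j₀ : Fin n} (h : 0 < N j₀) :
    ∏ j, z j ^ N j = z j₀ * (z j₀ ^ (N j₀ - 1) * ∏ j ∈ Finset.univ.erase j₀, z j ^ N j) := by
  rw [← mul_assoc, ← pow_succ', Nat.sub_add_cancel h,
    Finset.mul_prod_erase Finset.univ (fun j => z j ^ N j) (Finset.mem_univ j₀)]

/-- In characteristic `p`, the `p`-th power of an element of `A₁[t]` lies in `A₁` when `t ^ p ∈ A₁`. -/
theorem pow_mem_of_mem_adjoin_insert {p : ℕ} [Fact p.Prime] [CharP K p] (A₁ : Subalgebra k K) {t : K}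
    (htp : t ^ p ∈ A₁) {y : K} (hy : y ∈ Algebra.adjoin k (insert t (A₁ : Set K))) :
    y ^ p ∈ A₁ := by
  induction hy using Algebra.adjoin_induction with
  | mem x hx =>
    rcases hx with rfl | hx
    · exact htp
    · exact A₁.pow_mem hx p
  | algebraMap r => exact A₁.pow_mem (A₁.algebraMap_mem r) p
  | add x y _ _ hx hy => rw [add_pow_char]; exact A₁.add_mem hx hy
  | mul x y _ _ hx hy => rw [mul_pow]; exact A₁.mul_mem hx hy

end Glue

/-! ## §2 The stub -/

/-- **Stub `stub_toroidalExit` of the line `pfaff-line-log-final-forms`** (crux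
`Valuative.LuAlphaPTorsor`, stmt-0641): the toroidal exit — toric local uniformization of the
binomial hypersurface `t ^ p - c ^ p = u^M · B` (unit `B`, some `p ∤ M_i`) over a regular local base
along an arbitrary valuation ring. See the module docstring for the proof. -/
theorem stub_toroidalExit :
    ∀ p : ℕ, p.Prime → ∀ (k K : Type) [Field k] [CharP k p] [Field K] [Algebra k K] (O : ValuationSubring K) (A₁ : Subalgebra k K) (h₁ : A₁.toSubring ≤ O.toSubring) (t : K), A₁.FG → ∀ (htp : t ^ p ∈ A₁), IsFractionRing (Algebra.adjoin k (insert t (A₁ : Set K))) K → IsRegularLocalRing (Localization.AtPrime (Ideal.comap (Subring.inclusion h₁) (IsLocalRing.maximalIdeal O))) → (∃ (c : Localization.AtPrime (Ideal.comap (Subring.inclusion h₁) (IsLocalRing.maximalIdeal O))) (d : ℕ) (u : Fin d → Localization.AtPrime (Ideal.comap (Subring.inclusion h₁) (IsLocalRing.maximalIdeal O))) (M : Fin d → ℕ) (B : Localization.AtPrime (Ideal.comap (Subring.inclusion h₁) (IsLocalRing.maximalIdeal O))), Ideal.span (Set.range u) = IsLocalRing.maximalIdeal (Localization.AtPrime (Ideal.comap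 (Subring.inclusion h₁) (IsLocalRing.maximalIdeal O))) ∧ ringKrullDim (Localization.AtPrime (Ideal.comap (Subring.inclusion h₁) (IsLocalRing.maximalIdeal O))) = (d : WithBot ℕ∞) ∧ IsUnit B ∧ (∃ i, ¬ p ∣ M i) ∧ algebraMap A₁.toSubring (Localization.AtPrime (Ideal.comap (Subring.inclusion h₁) (IsLocalRing.maximalIdeal O))) ⟨t ^ p, htp⟩ - c ^ p = (Finset.univ.prod fun i => u i ^ M i) * B) → ∃ (A : Subalgebra k K) (h : A.toSubring ≤ O.toSubring), A₁ ≤ A ∧ t ∈ A ∧ A.FG ∧ IsFractionRing A K ∧ IsRegularLocalRing (Localization.AtPrime (Ideal.comap (Subring.inclusion h) (IsLocalRing.maximalIdeal O))) := by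
  intro p hp k K _ _ _ _ O A₁ h₁ t hfg htp hfr hreg hdat
  obtain ⟨c, d, u, M, B, hspan, hdim, hB, ⟨i₀, hi₀⟩, hrel⟩ := hdat
  classical
  haveI := Fact.mk hp
  haveI := hreg
  have hp0 : p ≠ 0 := hp.ne_zero
  -- ### the centre `𝔭` of `O` on `A₁`, `R = (A₁)_𝔭`, and the embedding `φ : R → K`
  set 𝔭 : Ideal A₁.toSubring := (maximalIdeal O).comap (Subring.inclusion h₁) with h𝔭def
  haveI : IsDomain (Localization.AtPrime 𝔭) := isDomain_of_isRegularLocalRing _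
  let φ : Localization.AtPrime 𝔭 →+* K := locToField A₁.toSubring 𝔭
  have hφa : ∀ a : A₁.toSubring, φ (algebraMap _ _ a) = a := locToField_algebraMap A₁.toSubring 𝔭
  have hφinj : Function.Injective φ := locToField_injective A₁.toSubring 𝔭
  have hsval : ∀ s : A₁.toSubring, s ∉ 𝔭 → O.valuation (s : K) = 1 := fun s hs =>
    (mem_primeCompl_centre_iff O A₁ h₁ s).mp hs
  have hφval : ∀ r : Localization.AtPrime 𝔭, ∃ a : A₁.toSubring,
      O.valuation (φ r) = O.valuation (a : K) ∧ (r ∈ maximalIdeal _ ↔ a ∈ 𝔭) := by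
    intro r
    obtain ⟨⟨a, s⟩, rfl⟩ := IsLocalization.mk'_surjective 𝔭.primeCompl r
    refine ⟨a, ?_, IsLocalization.AtPrime.mk'_mem_maximal_iff _ 𝔭 a s⟩
    change O.valuation (locToField A₁.toSubring 𝔭 _) = _
    rw [locToField_mk', map_mul, map_inv₀, hsval s s.2, inv_one, mul_one]
  have hφO : ∀ r, φ r ∈ O := fun r => by
    obtain ⟨a, ha, -⟩ := hφval r
    rw [← O.valuation_le_one_iff, ha, O.valuation_le_one_iff]
    exact h₁ a.2
  have hφlt : ∀ r ∈ maximalIdeal (Localization.AtPrime 𝔭), O.valuation (φ r) < 1 := fun r hr => by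
    obtain ⟨a, ha, hiff⟩ := hφval r
    rw [ha]
    have : Subring.inclusion h₁ a ∈ maximalIdeal O := hiff.mp hr
    exact (ValuationSubring.valuation_lt_one_iff O _).mp this
  haveI : CharP K p := charP_of_injective_algebraMap (algebraMap k K).injective p
  haveI : CharP (Localization.AtPrime 𝔭) p := φ.charP hφinj p
  -- ### §1 kill the unit: `u' = u` with `u'_{i₀} = u_{i₀} B^α`, `t' = (t - c) B^β`, `t'^p = u'^M`
  have hMi₀ : M i₀ ≠ 0 := fun h => hi₀ (h ▸ dvd_zero p)
  obtain ⟨α, -, hα⟩ := Nat.exists_mul_mod_eq_one_of_coprime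
    ((Nat.Prime.coprime_iff_not_dvd hp).mpr hi₀).symm hp.one_lt
  obtain ⟨β, hαβ⟩ : ∃ β : ℕ, M i₀ * α = p * β + 1 := ⟨M i₀ * α / p, by
    have := Nat.div_add_mod (M i₀ * α) p
    rw [hα] at this
    exact this.symm⟩
  let u' : Fin d → Localization.AtPrime 𝔭 := Function.update u i₀ (u i₀ * B ^ α)
  have hu'i₀ : u' i₀ = u i₀ * B ^ α := Function.update_self _ _ _
  have hu'ne : ∀ i, i ≠ i₀ → u' i = u i := fun i hi => Function.update_of_ne hi _ _
  have hassoc : ∀ i, Associated (u i) (u' i) := fun i => by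
    by_cases hi : i = i₀
    · subst hi
      rw [hu'i₀]
      exact associated_mul_unit_right (u i) _ (hB.pow α)
    · rw [hu'ne i hi]
  have hspan' : Ideal.span (Set.range u') = maximalIdeal _ := by
    rw [← Ideal.span_range_eq_of_associated hassoc, hspan]
  -- `u` and `u'` are regular systems of parameters
  have hrsop : IsRsopPart u := by
    refine ⟨hreg, 0, Fin.elim0, by simpa using hdim, ?_⟩
    rw [show Set.range (Fin.elim0 : Fin 0 → Localization.AtPrime 𝔭) = ∅ from
      Set.range_eq_empty _, Set.union_empty, hspan]
  have hrsop' : IsRsopPart u' := hrsop.of_associated hassoc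
  have hprod : ∏ i, u' i ^ M i = (∏ i, u i ^ M i) * B ^ (p * β + 1) := by
    rw [← Finset.mul_prod_erase _ _ (Finset.mem_univ i₀),
      ← Finset.mul_prod_erase Finset.univ (fun i => u i ^ M i) (Finset.mem_univ i₀), hu'i₀, mul_pow,
      ← pow_mul, mul_comm α, hαβ]
    rw [Finset.prod_congr rfl fun i hi => by rw [hu'ne i (Finset.ne_of_mem_erase hi)]]
    ring
  have hrel' : (algebraMap A₁.toSubring (Localization.AtPrime 𝔭) ⟨t ^ p, htp⟩ - c ^ p) * B ^ (p * β)
      = ∏ i, u' i ^ M i := by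
    rw [hprod, hrel, pow_succ]
    ring
  -- the data inside `K`
  let v : Fin d → K := fun i => φ (u' i)
  set t' : K := (t - φ c) * φ B ^ β with ht'
  have ht'p : t' ^ p = ∏ i, v i ^ M i := by
    have := congrArg φ hrel'
    rw [map_mul, map_sub, map_pow, map_pow, hφa, map_prod] at this
    rw [ht', mul_pow, sub_pow_char, ← pow_mul, mul_comm β p]
    rw [this]
    exact Finset.prod_congr rfl fun i _ => map_pow φ _ _
  have hBK : φ B * φ ↑(hB.unit⁻¹) = 1 := by
    rw [← map_mul, IsUnit.mul_val_inv, map_one]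
  have ht_eq : t - φ c = t' * φ (↑(hB.unit⁻¹) ^ β) := by
    rw [ht', map_pow, mul_assoc, ← mul_pow, hBK, one_pow, mul_one]
  -- ### §2 the monomial chart
  have hv0 : ∀ i, v i ≠ 0 := fun i => (map_ne_zero_iff φ hφinj).mpr (hrsop'.ne_zero i)
  have hv1 : ∀ i, O.valuation (v i) < 1 := fun i => hφlt _ (hrsop'.mem_maximalIdeal i)
  have ht'1 : O.valuation t' < 1 := by
    by_contra hge
    push Not at hge
    have h1 : 1 ≤ O.valuation (t' ^ p) := by rw [map_pow]; exact one_le_pow₀ hge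
    have h2 : O.valuation (t' ^ p) < 1 := by
      rw [ht'p, map_prod, ← Finset.mul_prod_erase _ _ (Finset.mem_univ i₀), map_pow]
      refine lt_of_le_of_lt (mul_le_of_le_one_right' (Finset.prod_le_one' fun i _ => ?_)) ?_
      · rw [map_pow]; exact pow_le_one' (hv1 i).le _
      · exact pow_lt_one₀ zero_le (hv1 i₀) hMi₀
    exact (lt_irrefl _ (lt_of_le_of_lt h1 h2))
  have hind : ∀ a b : Fin d → ℕ, ∏ i, v i ^ a i = ∏ i, v i ^ b i → a = b := by
    intro a b hab
    have hab' : ∏ i, u' i ^ a i = ∏ i, u' i ^ b i := by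
      apply hφinj
      rw [map_prod, map_prod]
      simpa [v] using hab
    have h1 : ∃ b' ∈ ({b} : Set (Fin d → ℕ)), b' ≤ a := by
      rw [← hrsop'.uPow_mem_span_uPow_iff {b} a]
      change ∏ i, u' i ^ a i ∈ Ideal.span (CossartPiltant.uPow u' '' {b})
      rw [hab', Set.image_singleton]
      exact Ideal.subset_span rfl
    have h2 : ∃ a' ∈ ({a} : Set (Fin d → ℕ)), a' ≤ b := by
      rw [← hrsop'.uPow_mem_span_uPow_iff {a} b]
      change ∏ i, u' i ^ b i ∈ Ideal.span (CossartPiltant.uPow u' '' {a})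
      rw [← hab', Set.image_singleton]
      exact Ideal.subset_span rfl
    obtain ⟨_, rfl, hba⟩ := h1
    obtain ⟨_, rfl, hab''⟩ := h2
    exact le_antisymm hab'' hba
  obtain ⟨n, z, N, NT, hnd, hzO, hzv, hzw⟩ :=
    exists_monomial_chart p O v t' M hv0 hv1 ht'1 ht'p hind
  -- ### §3 the model `A = A₁[t, z]`
  obtain ⟨S₁, hS₁⟩ := hfg
  let x : Option (Fin n) → K := fun o => o.elim t z
  have htO : t ∈ O := mem_of_pow_mem' O hp0 (h₁ htp)
  have hxO : ∀ o, x o ∈ O := fun o => by cases o with | none => exact htO | some j => exact hzO j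
  let G : Finset K := S₁ ∪ Finset.univ.image x
  set A : Subalgebra k K := Algebra.adjoin k (G : Set K) with hA
  have hGA : ∀ y ∈ G, y ∈ A := fun y hy => Algebra.subset_adjoin hy
  have hA₁A : A₁ ≤ A := by
    rw [← hS₁]
    exact Algebra.adjoin_mono (by simp [G])
  have hxA : ∀ o, x o ∈ A := fun o => hGA _ (by simp [G])
  have htA : t ∈ A := hxA none
  have hAO : A.toSubring ≤ O.toSubring := by
    let Oalg : Subalgebra k K :=
      { O.toSubring with algebraMap_mem' := fun r => h₁ (A₁.algebraMap_mem r) }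
    change A ≤ Oalg
    refine Algebra.adjoin_le fun y hy => ?_
    rcases Finset.mem_union.mp (Finset.mem_coe.mp hy) with hy | hy
    · exact h₁ (hS₁ ▸ Algebra.subset_adjoin hy : y ∈ A₁)
    · obtain ⟨o, -, rfl⟩ := Finset.mem_image.mp hy
      exact hxO o
  have hAfg : A.FG := ⟨G, rfl⟩
  have hAfr : IsFractionRing A K := by
    refine isFractionRing_of_le (Algebra.adjoin_le ?_) hfr
    rintro y (rfl | hy)
    · exact htA
    · exact hA₁A hy
  refine ⟨A, hAO, hA₁A, htA, hAfg, hAfr, ?_⟩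
  -- ### §4 regularity at the centre: the engine
  have hle' : A₁.toSubring ≤ A.toSubring := fun y hy => hA₁A hy
  let ι : A₁.toSubring →+* A.toSubring := Subring.inclusion hle'
  set 𝔮 : Ideal A.toSubring := (maximalIdeal O).comap (Subring.inclusion hAO) with h𝔮def
  have h𝔭𝔮 : 𝔭 = 𝔮.comap ι := by
    ext y
    rfl
  letI algA₁ : Algebra k A₁.toSubring := A₁.algebra
  letI algA : Algebra k A.toSubring := A.algebra
  haveI : Algebra.FiniteType k A₁.toSubring := (Subalgebra.fg_iff_finiteType A₁).mp ⟨S₁, hS₁⟩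
  haveI : Algebra.FiniteType k A.toSubring := (Subalgebra.fg_iff_finiteType A).mp hAfg
  have hι : Function.Injective ι := Subring.inclusion_injective hle'
  have hιk : ∀ r, ι (algebraMap k A₁.toSubring r) = algebraMap k A.toSubring r := fun r => rfl
  -- `A` is algebraic over `A₁` (Frobenius: `y^p ∈ Frac A₁`)
  have halg : ∀ y : A.toSubring, ∃ f : Polynomial A₁.toSubring, f ≠ 0 ∧ Polynomial.eval₂ ι y f = 0 := by
    intro y
    obtain ⟨a, b, hb, hab⟩ :=
      IsFractionRing.div_surjective (A := Algebra.adjoin k (insert t (A₁ : Set K))) (y : K)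
    have hab' : (a : K) / (b : K) = y := hab
    have hb0 : (b : K) ≠ 0 := fun h => nonZeroDivisors.ne_zero hb (Subtype.ext h)
    have hap : (a : K) ^ p ∈ A₁ := pow_mem_of_mem_adjoin_insert A₁ htp a.2
    have hbp : (b : K) ^ p ∈ A₁ := pow_mem_of_mem_adjoin_insert A₁ htp b.2
    refine ⟨Polynomial.C ⟨(b : K) ^ p, hbp⟩ * Polynomial.X ^ p - Polynomial.C ⟨(a : K) ^ p, hap⟩, ?_, ?_⟩
    · intro h
      have := congrArg (fun f => Polynomial.coeff f p) h
      simp only [Polynomial.coeff_sub, Polynomial.coeff_C_mul, Polynomial.coeff_X_pow_self, mul_one,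
        Polynomial.coeff_C, hp0, if_false, sub_zero, Polynomial.coeff_zero] at this
      exact pow_ne_zero p hb0 (congrArg Subtype.val this)
    · apply Subtype.val_injective
      simp only [Polynomial.eval₂_sub, Polynomial.eval₂_mul, Polynomial.eval₂_C, Polynomial.eval₂_X_pow]
      change (b : K) ^ p * (y : K) ^ p - (a : K) ^ p = 0
      rw [← hab', div_pow, mul_div_cancel₀ _ (pow_ne_zero p hb0), sub_self]
  -- generators and the presentation
  let x' : Option (Fin n) → A.toSubring := fun o => ⟨x o, hxA o⟩
  have hsurj : Function.Surjective (MvPolynomial.eval₂Hom ι x') := by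
    intro y
    suffices h : ∀ w ∈ A, ∃ P : MvPolynomial (Option (Fin n)) A₁.toSubring,
        ((MvPolynomial.eval₂Hom ι x' P : A.toSubring) : K) = w by
      obtain ⟨P, hP⟩ := h y y.2
      exact ⟨P, Subtype.ext hP⟩
    intro w hw
    rw [hA] at hw
    induction hw using Algebra.adjoin_induction with
    | mem y hy =>
      rcases Finset.mem_union.mp (Finset.mem_coe.mp hy) with hy | hy
      · have hy₁ : y ∈ A₁ := hS₁ ▸ Algebra.subset_adjoin hy
        exact ⟨MvPolynomial.C ⟨y, hy₁⟩, by simp; rfl⟩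
      · obtain ⟨o, -, rfl⟩ := Finset.mem_image.mp hy
        exact ⟨MvPolynomial.X o, by simp [x']⟩
    | algebraMap r => exact ⟨MvPolynomial.C ⟨algebraMap k K r, A₁.algebraMap_mem r⟩, by simp; rfl⟩
    | add y₁ y₂ _ _ h₁' h₂' =>
      obtain ⟨P₁, hP₁⟩ := h₁'
      obtain ⟨P₂, hP₂⟩ := h₂'
      exact ⟨P₁ + P₂, by rw [map_add, Subring.coe_add, hP₁, hP₂]⟩
    | mul y₁ y₂ _ _ h₁' h₂' =>
      obtain ⟨P₁, hP₁⟩ := h₁'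
      obtain ⟨P₂, hP₂⟩ := h₂'
      exact ⟨P₁ * P₂, by rw [map_mul, Subring.coe_mul, hP₁, hP₂]⟩
  -- the index sets
  let J : Finset (Fin n) := Finset.univ.filter fun j => O.valuation (z j) < 1
  let I₁ : Finset (Option (Fin n)) := J.map ⟨some, Option.some_injective _⟩
  let I₀ : Finset (Option (Fin n)) := insert none I₁
  have hmemI₁ : ∀ j, O.valuation (z j) < 1 → some j ∈ I₁ := fun j hj =>
    Finset.mem_map.mpr ⟨j, Finset.mem_filter.mpr ⟨Finset.mem_univ j, hj⟩, rfl⟩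
  have hI₁ : ∀ i ∈ I₁, x' i ∈ 𝔮 := by
    intro i hi
    obtain ⟨j, hj, rfl⟩ := Finset.mem_map.mp hi
    have hj' : O.valuation (z j) < 1 := (Finset.mem_filter.mp hj).2
    change Subring.inclusion hAO (x' (some j)) ∈ maximalIdeal O
    exact (ValuationSubring.valuation_lt_one_iff O _).mpr hj'
  have hcount : I₁.card + Fintype.card (Option (Fin n)) ≤ d + I₀.card := by
    have h1 : I₀.card = I₁.card + 1 := by
      rw [Finset.card_insert_of_notMem]
      intro h
      obtain ⟨j, -, hj⟩ := Finset.mem_map.mp h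
      exact Option.some_ne_none j hj
    rw [h1, Fintype.card_option, Fintype.card_fin]
    omega
  -- the embedding `jS : A_𝔮 → K` and the transfer of identities
  let jS := locToField A.toSubring 𝔮
  have hjSinj : Function.Injective jS := locToField_injective A.toSubring 𝔮
  have hjSa : ∀ y : A.toSubring, jS (algebraMap _ _ y) = y := locToField_algebraMap A.toSubring 𝔮
  have hjSℓ : ∀ r, jS (Localization.localRingHom 𝔭 𝔮 ι h𝔭𝔮 r) = φ r :=
    locToField_localRingHom hle' 𝔮 𝔭 h𝔭𝔮
  -- a power-product of the `z_j` of value `< 1` lies in the ideal `(z_j : j ∈ I₁) A_𝔮`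
  have hmono : ∀ (N' : Fin n → ℕ), O.valuation (∏ j, z j ^ N' j) < 1 →
      ∀ s : Localization.AtPrime 𝔮, jS s = ∏ j, z j ^ N' j → ∀ s' : Localization.AtPrime 𝔮,
      s * s' ∈ Ideal.span ((fun i => algebraMap A.toSubring (Localization.AtPrime 𝔮) (x' i)) '' I₁) := by
    intro N' hN' s hs s'
    obtain ⟨j₀, hj₀, hj₀1⟩ := exists_factor_lt_one O z hzO N' hN'
    have hrest : z j₀ ^ (N' j₀ - 1) * ∏ j ∈ Finset.univ.erase j₀, z j ^ N' j ∈ A :=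
      A.mul_mem (A.pow_mem (hxA (some j₀)) _) (A.prod_mem fun j _ => A.pow_mem (hxA (some j)) _)
    have hs' : s = algebraMap A.toSubring _ (x' (some j₀)) * algebraMap A.toSubring _ ⟨_, hrest⟩ := by
      apply hjSinj
      rw [hs, map_mul, hjSa, hjSa, prod_pow_eq_mul_of_pos z N' hj₀]
      rfl
    rw [hs', mul_assoc]
    exact Ideal.mul_mem_right _ _ (Ideal.subset_span ⟨some j₀, hmemI₁ j₀ hj₀1, rfl⟩)
  have hmax : ∀ r ∈ maximalIdeal (Localization.AtPrime 𝔭), Localization.localRingHom 𝔭 𝔮 ι h𝔭𝔮 r ∈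
      Ideal.span ((fun i => algebraMap A.toSubring (Localization.AtPrime 𝔮) (x' i)) '' I₁) := by
    intro r hr
    rw [← hspan'] at hr
    obtain ⟨cr, rfl⟩ := Ideal.mem_span_range_iff_exists_fun.mp hr
    rw [map_sum]
    refine Ideal.sum_mem _ fun i _ => ?_
    rw [map_mul]
    refine Ideal.mul_mem_left _ _ ?_
    have := hmono (N i) (by rw [← hzv i]; exact hv1 i) (Localization.localRingHom 𝔭 𝔮 ι h𝔭𝔮 (u' i))
      (by rw [hjSℓ, ← hzv i]) 1
    rwa [mul_one] at this
  have hI₀ : ∀ i ∈ I₀, ∃ r : Localization.AtPrime 𝔭,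
      algebraMap A.toSubring (Localization.AtPrime 𝔮) (x' i) - Localization.localRingHom 𝔭 𝔮 ι h𝔭𝔮 r ∈
        Ideal.span ((fun i => algebraMap A.toSubring (Localization.AtPrime 𝔮) (x' i)) '' I₁) := by
    intro i hi
    rcases Finset.mem_insert.mp hi with rfl | hi
    · refine ⟨c, ?_⟩
      -- `t - c = t' · B^{-β}` with `t' = z^{N_T}` of value `< 1`
      have ht'A : t' ∈ A := by
        rw [hzw]
        exact A.prod_mem fun j _ => A.pow_mem (hxA (some j)) _
      have hNT1 : O.valuation (∏ j, z j ^ NT j) < 1 := by rw [← hzw]; exact ht'1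
      have key : algebraMap A.toSubring (Localization.AtPrime 𝔮) (x' none) -
          Localization.localRingHom 𝔭 𝔮 ι h𝔭𝔮 c =
          algebraMap A.toSubring (Localization.AtPrime 𝔮) ⟨t', ht'A⟩ *
            Localization.localRingHom 𝔭 𝔮 ι h𝔭𝔮 (↑(hB.unit⁻¹) ^ β) := by
        apply hjSinj
        rw [map_sub, map_mul, hjSa, hjSℓ, hjSa, hjSℓ]
        exact ht_eq
      rw [key]
      exact hmono NT hNT1 _ ((hjSa _).trans hzw) _
    · exact ⟨0, by rw [map_zero, sub_zero]; exact Ideal.subset_span ⟨i, hi, rfl⟩⟩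
  exact isRegularLocalRing_of_presentation ι hι hιk halg 𝔮 𝔭 h𝔭𝔮 d hdim x' hsurj I₁ I₀ hI₁ hmax hI₀
    (by simpa using hcount)

end Summit.ResolutionOfSingularities.ResolutionOfSingularities.Theorems.PfaffLine

end
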